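import Summits.MatrixMultiplication.MatrixMultiplication.Theses.FarEdgeDescent
import Literature.Computability.AlgebraicComplexity.RectangularExponentInformationBound
import HarnessLib

/-!
# Route `FarEdgeDescent` — the α-PRICE of the special leaf `FiniteSaturation` (stmt-MatrixMultiplication-23739),
PROVED: a saturated far shape `K` forces the dual zero `ω(1, 2/(K+1), 1) = 2`, i.e. `α ≥ 2/(K+1)`

Support module for the rank-3 crux `FiniteSaturation` (`∃ k ≥ 2, ω(1,k,1) = k + 1`: the Lotti–Romani infimum
`e(k) := ω(1,k,1) − (k+1) → 0` is ATTAINED at an integer shape).  The CW_q-direct laser family never saturates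
a finite shape (`ε_q(k) > 0` for every `k`, barrier of record), so the leaf needs a price tag that print can
test.  This file proves one, about the TRUE exponents and with no hypotheses, by transporting information
ACROSS the square — from the far side (shape `K > 1`) to the dual side (shape `2/(K+1) < 1`):

* `omegaRect_dual_le`: `(K+1)·ω(1,1,2/(K+1)) ≤ 2·ω(1,K,1)` — glue `⟨n,n^K,n⟩` with its transpose shape
  `⟨n^K,n,n⟩` (`LottiRomani1983_subadditive`, `omegaRect_swap₁₂`) to get `ω(K+1,K+1,2) ≤ 2·ω(1,K,1)`, then
  rescale by `ν = K+1` (`LottiRomani1983_homogeneous`);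
* `dualDefect_le_excess`: in defect form `d(2/(K+1)) ≤ (2/(K+1))·e(K)`, `d(s) := ω(1,s,1) − 2`;
* `dualSaturation_of_saturated`, `alpha_ge_of_saturated`: `e(K) = 0 ⟹ d(2/(K+1)) = 0 ⟹ α ≥ 2/(K+1)`;
* `alpha_ge_of_twoSaturation`: `E₂ := ω(1,2,1) = 3 ⟹ α ≥ 2/3` — against the record `α > 0.321334`
  (Vassilevska Williams–Xu–Xu–Zhou 2024) the `K = 2` special piece more than DOUBLES the dual exponent;
  `alpha_ge_of_finiteSaturation`: `FiniteSaturation ⟹ ∃ k ≥ 2, α ≥ 2/(k+1)`;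
* the PRICE read as a kill criterion: `not_saturated_of_dualExponentAlpha_lt` — any upper bound `α < 2/(K+1)`
  refutes saturation at every real shape `≤ K` (`excess_pos_of_dualExponentAlpha_lt`, quantitative:
  `e(K) ≥ ((K+1)/2)·d(2/(K+1)) > 0`).

Written by the decomp-mm lens-2 planner seat (gen 8) from the kernel `HOME/decomp-mm-lens-2/FarEdgeDescent_v7.lean`
§E; imports only BUILT modules (the route file + Literature).
[cite: LottiRomani1983, §2 (p. 174)] [cite: VassilevskaWilliamsXuXuZhou2024, Thm. 1.2]
-/

set_option linter.dupNamespace false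

noncomputable section

namespace Summit.MatrixMultiplication.MatrixMultiplication.Theorems.FarEdgeDescentAlphaPrice

open Literature.Computability.AlgebraicComplexity
open Summit.MatrixMultiplication.MatrixMultiplication.Theses.FarEdgeDescent

/-! ## Cross-square transport -/

/-- **Cross-square transport.** `(K+1)·ω(1,1,2/(K+1)) ≤ 2·ω(1,K,1)` for every `K > 0`. -/
theorem omegaRect_dual_le {K : ℝ} (hK : 0 < K) :
    (K + 1) * omegaRect ℂ 1 1 (2 / (K + 1)) ≤ 2 * omegaRect ℂ 1 K 1 := by
  have hK1 : 0 < K + 1 := by linarith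
  have hsub := LottiRomani1983_subadditive ℂ 1 K 1 K 1 1
  rw [omegaRect_swap₁₂ ℂ K 1 1, show (1 : ℝ) + K = K + 1 by ring, show (1 : ℝ) + 1 = 2 by norm_num,
    ← two_mul] at hsub
  have hhom := LottiRomani1983_homogeneous ℂ (ν := K + 1) (x := 1) (y := 1) (z := 2 / (K + 1))
    hK1.le zero_le_one zero_le_one (by positivity)
  have e3 : (K + 1) * (2 / (K + 1)) = 2 := by field_simp
  rw [mul_one, e3] at hhom
  rw [← hhom]
  exact hsub

/-- Defect form: `d(2/(K+1)) ≤ (2/(K+1))·e(K)`, where `d(s) := ω(1,s,1) − 2` is the dual-side defect and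
`e(K) := ω(1,K,1) − (K+1)` the far-side excess. -/
theorem dualDefect_le_excess {K : ℝ} (hK : 0 < K) :
    omegaRect ℂ 1 (2 / (K + 1)) 1 - 2 ≤ 2 / (K + 1) * (omegaRect ℂ 1 K 1 - (K + 1)) := by
  have hK1 : 0 < K + 1 := by linarith
  have h := omegaRect_dual_le hK
  rw [omegaRect_one_mid_one ℂ (2 / (K + 1)), div_mul_eq_mul_div, le_div_iff₀ hK1]
  linarith

/-- The same inequality solved for the excess: `e(K) ≥ ((K+1)/2)·d(2/(K+1))`. -/
theorem excess_ge_dualDefect {K : ℝ} (hK : 0 < K) :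
    (K + 1) / 2 * (omegaRect ℂ 1 (2 / (K + 1)) 1 - 2) ≤ omegaRect ℂ 1 K 1 - (K + 1) := by
  have hK1 : 0 < K + 1 := by linarith
  have h := dualDefect_le_excess hK
  have h' := mul_le_mul_of_nonneg_left h (by positivity : (0 : ℝ) ≤ (K + 1) / 2)
  have e : (K + 1) / 2 * (2 / (K + 1) * (omegaRect ℂ 1 K 1 - (K + 1))) = omegaRect ℂ 1 K 1 - (K + 1) := by
    field_simp
  linarith [e]

/-! ## A saturated far shape forces a dual zero: the α-price -/

/-- A SATURATED far shape forces a DUAL ZERO: `e(K) = 0 ⟹ ω(1, 2/(K+1), 1) = 2`. -/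
theorem dualSaturation_of_saturated {K : ℝ} (hK : 0 < K) (hs : omegaRect ℂ 1 K 1 = K + 1) :
    omegaRect ℂ 1 (2 / (K + 1)) 1 = 2 := by
  have h := dualDefect_le_excess hK
  rw [hs, sub_self, mul_zero] at h
  exact le_antisymm (by linarith) (two_le_omegaRect_one_mid_one ℂ _)

/-- … hence **`α ≥ 2/(K+1)`** (`le_dualExponentAlpha_of_omegaRect_eq_two`). -/
theorem alpha_ge_of_saturated {K : ℝ} (hK : 0 < K) (hs : omegaRect ℂ 1 K 1 = K + 1) :
    2 / (K + 1) ≤ dualExponentAlpha ℂ :=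
  le_dualExponentAlpha_of_omegaRect_eq_two ℂ (dualSaturation_of_saturated hK hs)

/-- **`E₂ ⟹ α ≥ 2/3`**: saturation of `⟨n, n², n⟩` more than doubles the dual exponent's record
`0.321334`. -/
theorem alpha_ge_of_twoSaturation (h : omegaRect ℂ 1 2 1 = 3) : 2 / 3 ≤ dualExponentAlpha ℂ := by
  have h' : omegaRect ℂ 1 2 1 = 2 + 1 := by rw [h]; norm_num
  have := alpha_ge_of_saturated two_pos h'
  norm_num at this
  exact this

/-- **The α-price of the special leaf, by name**: `FiniteSaturation` at `k` forces `α ≥ 2/(k+1)`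
(so saturation at any `k ≤ 5` already beats the α record `0.321334`). -/
theorem alpha_ge_of_finiteSaturation (h : FiniteSaturation) :
    ∃ k : ℕ, 2 ≤ k ∧ 2 / ((k : ℝ) + 1) ≤ dualExponentAlpha ℂ := by
  obtain ⟨k, hk, hs⟩ := h
  exact ⟨k, hk, alpha_ge_of_saturated (by exact_mod_cast (by omega : 0 < k)) hs⟩

/-! ## The price as a kill criterion -/

/-- Quantitative: if `α < 2/(K+1)` then `e(K) > 0` — indeed `e(K) ≥ ((K+1)/2)·d(2/(K+1)) > 0`
(`two_lt_omegaRect_of_dualExponentAlpha_lt`). -/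
theorem excess_pos_of_dualExponentAlpha_lt {K : ℝ} (hK : 0 < K)
    (hα : dualExponentAlpha ℂ < 2 / (K + 1)) : 0 < omegaRect ℂ 1 K 1 - (K + 1) := by
  have hK1 : 0 < K + 1 := by linarith
  have hd : 2 < omegaRect ℂ 1 (2 / (K + 1)) 1 := two_lt_omegaRect_of_dualExponentAlpha_lt ℂ hα
  have h := excess_ge_dualDefect hK
  have hpos : 0 < (K + 1) / 2 * (omegaRect ℂ 1 (2 / (K + 1)) 1 - 2) :=
    mul_pos (by positivity) (by linarith)
  linarith

/-- **Kill criterion for the special leaf up to `K`:** an upper bound `α < 2/(K+1)` refutes saturation at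
EVERY real shape `k ∈ (0, K]` (the excess is non-increasing in the shape). -/
theorem not_saturated_of_dualExponentAlpha_lt {K k : ℝ} (hk : 0 < k) (hkK : k ≤ K)
    (hα : dualExponentAlpha ℂ < 2 / (K + 1)) : omegaRect ℂ 1 k 1 ≠ k + 1 := by
  have hK : 0 < K := lt_of_lt_of_le hk hkK
  have hk1 : 0 < k + 1 := by linarith
  have hK1 : 0 < K + 1 := by linarith
  have hα' : dualExponentAlpha ℂ < 2 / (k + 1) := by
    refine lt_of_lt_of_le hα ?_
    exact div_le_div_of_nonneg_left (by norm_num) hk1 (by linarith)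
  have h := excess_pos_of_dualExponentAlpha_lt hk hα'
  intro hs
  rw [hs] at h
  simp at h

/-- Contrapositive, by name: `FiniteSaturation` with witness `k ≤ K` is incompatible with `α < 2/(K+1)`;
in particular `α < 2/3` would refute `E₂`, and `α < 2/(K+1)` pushes every saturated integer shape beyond `K`. -/
theorem finiteSaturation_witness_gt_of_dualExponentAlpha_lt {K : ℝ} (hα : dualExponentAlpha ℂ < 2 / (K + 1))
    {k : ℕ} (hk : 2 ≤ k) (hs : omegaRect ℂ 1 k 1 = k + 1) : K < k := by
  by_contra hle
  rw [not_lt] at hle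
  exact not_saturated_of_dualExponentAlpha_lt (k := (k : ℝ)) (by exact_mod_cast (by omega : 0 < k)) hle hα hs

end Summit.MatrixMultiplication.MatrixMultiplication.Theorems.FarEdgeDescentAlphaPrice

end
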